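import Summits.CriticalPhenomena.PercolationContinuityZ3.Theorems.PercNearOneGluingNoHeavyLowerTailQ44SingleSourceEMonoA
import Summits.CriticalPhenomena.PercolationContinuityZ3.Theorems.PercNearOneGluingNoHeavyLowerTailQ44bGluingAB
import Literature.Probability.Percolation.StrongHarrisThreePoint
import HarnessLib

/-!
# Conjecture W (row `Q44`, all `n`) when the terminal `a` is attached only to the other terminals:
# the three-port transfer at `{b,c,y}` reduces it to the Aas–Gladkov three-point inequality

Support file for crux `stmt-CriticalPhenomena-4575` (master-family programme; Conjecture W = `TwoCopyMono.GoodKernel kerQ44`,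
open for all `n`), seat `prim-l12-p6` gen 27; memo `run/shared/lean/prim/prim-l12/FROM-prim-l12-p6-g27-PORT-TRANSFER.md` §1–§3.

Conjecture W is the four-point inequality, in the cells `cᵢ = FourPointAtoms.cell w a b c y i` of `(a,b,c,y)`,
`2(c₁₁c₉ + c₁₁c₈ + c₆c₈ + c₆c₁ + c₁c₈) + (c₂c₁₃ + c₁c₁₃ + c₅c₁₂ + c₁c₁₂ + c₆c₁₀ + c₆c₇ + c₂c₁₀ + c₅c₇) ≤ 2(c₁₁+c₁₄)c₀`
(the literal cell form of `TwoCopyMono.sum_kerQ44_cell` / `ConjW.q44_cells_of_mixW`).  Seat `prim-l12-p6` gen 25 observed that on the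
PENDANT class (one pair `a–b`) it IS Gladkov's three-point inequality for `(b,c,y)`.  THIS FILE proves it for every finite weighted graph
in which, once the three terminal pairs `s(a,b), s(a,c), s(a,y)` are closed, `a` is almost surely joined to none of `b, c, y` — e.g.
whenever every neighbour of `a` of positive weight is a terminal, with ANY weights on the three terminal pairs:

* `ConjWPort.q44_cells_of_isolated_core` — algebraic core: with `w₀ = w[s(a,b)↦0][s(a,c)↦0][s(a,y)↦0]`, if the ten cells of `w₀` joining
  `a` to a terminal vanish, the inequality holds for `w`.  PROOF = the memo's THREE-PORT TRANSFER: three one-bond expansions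
  (`SingleSourceLaw.cell_oneBond` + the one-edge gluing dictionary `cell_update_one'`) write every cell of `w` as a polynomial in
  `α = w(ab)`, `β = w₁(ac)`, `γ = w₂(ay)` and the three-point law `(q, u_b, u_c, u_y, x) = (c₀, c₁, c₂, c₃, c₇)(w₀)` of `(b,c,y)`; the defect
  `2(c₁₁+c₁₄)c₀ − 2·B1 − D` is then IDENTICALLY
  `C_qx·[xq − u_bu_c − u_bu_y − u_cu_y] + f_bc·u_bu_c + f_by·u_bu_y + f_cy·u_cu_y + C_qb·q(u_b+u_c) + C_qy·q·u_y` with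
  `C_qx = (1−α)(1−β)(1−γ)[α+β+γ(2−α−β)]`, `f_bc = γ(1−γ)[α(1−α)(1−β)+β(1−β)(1−α)]`, `f_by = β(1−β)(1−γ)(1−α)[α(1−γ)+2γ]`,
  `f_cy = (1−γ)(1−α)(1−β)[αβ+γ(2−αβ)]`, `C_qb = αβγ(1−α)(1−β)(1−γ)`, `C_qy = 2βγ(1−α)(1−β)(1−γ)` (all ≥ 0 on the unit cube), and
  `xq ≥ u_bu_c + u_bu_y + u_cu_y` is Gladkov's Cor. 4.2 (Aas–Gladkov) for `(b,c,y)` under `w₀` (`prodBernoulli_threePoint_strongHarris`).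
* `ConjWPort.q44_cells_of_terminal_ports` — the measure-level form: hypotheses `P_{w₀}(a↔b) = P_{w₀}(a↔c) = P_{w₀}(a↔y) = 0`.

(The general THREE-PORT TRANSFER of the memo: for `G = K ⊕_{b,c,y} R`, Conjecture W for `G` is a quadratic form in the three-point law of
`(b,c,y)` in `R` with only the monomials `q², q·u, q·x, u·u'`, and the extension criterion; here `K` = the star `a–{b,c,y}`.)
The one-edge gluing dictionary of `…Q44SingleSourceEMonoATerminal` and `Q44PendantA.sk3_bcy_cells` are re-derived privately in generic
form (those modules had no farm build at the time of writing).  No sorries, no named facts, no definitions, standard axioms.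
-/

noncomputable section

namespace Summit.CriticalPhenomena.PercolationContinuityZ3.Theorems

namespace ConjWPort

open MeasureTheory Set Literature.Probability.LatticeModels Literature.Probability.Percolation
open FourPointAtoms
open Summit.CriticalPhenomena.PercolationContinuityZ3.Cruxes.AdditiveGluing.TieLine.ConnAtoms
open scoped Classical

variable {n : ℕ}

/-! ### Tools: the one-edge gluing dictionary at a pair of marked points, and SK3 for `(b,c,y)` in four-point cells -/

/-- Pattern of `ω ∪ {s(p,q)}` for marked points `p = quad u`, `q = quad v`: blocks of `π` joined through `{u,v}`. [folklore] -/
private theorem hasPattern_insert' (a b c y : Fin n) (u v : Fin 4) {p q : Fin n} (hp : quad a b c y u = p)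
    (hq : quad a b c y v = q) (π₀ : Fin 4 → Fin 4) :
    HasPattern (quad a b c y) {ω : BondConfig (Fin n) | insert s(p, q) ω ∈ atom (quad a b c y) π₀}
      (fun π => ∀ j k : Fin 4, ((π j = π k) ∨ (π j = π u ∧ π v = π k) ∨ (π j = π v ∧ π u = π k)) ↔ π₀ j = π₀ k) := by
  subst hp; subst hq
  intro π _ ω hω
  simp only [Set.mem_setOf_eq, mem_atom]
  have hω' : ∀ j k : Fin 4, (openGraph ω).Reachable (quad a b c y j) (quad a b c y k) ↔ π j = π k := hω
  simp only [KNSep.reachable_insert_iff, hω']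

/-- **One-edge gluing dictionary** at the marked pair `s(p,q)`, `p = quad u`, `q = quad v`: a cell of `w[s(p,q)↦1]` is the sum of
the cells of `w[s(p,q)↦0]` whose pattern becomes it when the blocks of `u` and `v` are merged
(`P_{w[e↦1]}(E) = P_{w[e↦0]}(ω ∪ {e} ∈ E)`). [this work] -/
private theorem cell_update_one' (w : Sym2 (Fin n) → unitInterval) (a b c y : Fin n) (u v : Fin 4) {p q : Fin n}
    (hp : quad a b c y u = p) (hq : quad a b c y v = q) (i : Fin 15) :
    cell (Function.update w s(p, q) 1) a b c y i =
      (if (∀ j k : Fin 4, ((pat4 0 j = pat4 0 k) ∨ (pat4 0 j = pat4 0 u ∧ pat4 0 v = pat4 0 k) ∨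
          (pat4 0 j = pat4 0 v ∧ pat4 0 u = pat4 0 k)) ↔ pat4 i j = pat4 i k) then cell (Function.update w s(p, q) 0) a b c y 0 else 0) +
      (if (∀ j k : Fin 4, ((pat4 1 j = pat4 1 k) ∨ (pat4 1 j = pat4 1 u ∧ pat4 1 v = pat4 1 k) ∨
          (pat4 1 j = pat4 1 v ∧ pat4 1 u = pat4 1 k)) ↔ pat4 i j = pat4 i k) then cell (Function.update w s(p, q) 0) a b c y 1 else 0) +
      (if (∀ j k : Fin 4, ((pat4 2 j = pat4 2 k) ∨ (pat4 2 j = pat4 2 u ∧ pat4 2 v = pat4 2 k) ∨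
          (pat4 2 j = pat4 2 v ∧ pat4 2 u = pat4 2 k)) ↔ pat4 i j = pat4 i k) then cell (Function.update w s(p, q) 0) a b c y 2 else 0) +
      (if (∀ j k : Fin 4, ((pat4 3 j = pat4 3 k) ∨ (pat4 3 j = pat4 3 u ∧ pat4 3 v = pat4 3 k) ∨
          (pat4 3 j = pat4 3 v ∧ pat4 3 u = pat4 3 k)) ↔ pat4 i j = pat4 i k) then cell (Function.update w s(p, q) 0) a b c y 3 else 0) +
      (if (∀ j k : Fin 4, ((pat4 4 j = pat4 4 k) ∨ (pat4 4 j = pat4 4 u ∧ pat4 4 v = pat4 4 k) ∨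
          (pat4 4 j = pat4 4 v ∧ pat4 4 u = pat4 4 k)) ↔ pat4 i j = pat4 i k) then cell (Function.update w s(p, q) 0) a b c y 4 else 0) +
      (if (∀ j k : Fin 4, ((pat4 5 j = pat4 5 k) ∨ (pat4 5 j = pat4 5 u ∧ pat4 5 v = pat4 5 k) ∨
          (pat4 5 j = pat4 5 v ∧ pat4 5 u = pat4 5 k)) ↔ pat4 i j = pat4 i k) then cell (Function.update w s(p, q) 0) a b c y 5 else 0) +
      (if (∀ j k : Fin 4, ((pat4 6 j = pat4 6 k) ∨ (pat4 6 j = pat4 6 u ∧ pat4 6 v = pat4 6 k) ∨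
          (pat4 6 j = pat4 6 v ∧ pat4 6 u = pat4 6 k)) ↔ pat4 i j = pat4 i k) then cell (Function.update w s(p, q) 0) a b c y 6 else 0) +
      (if (∀ j k : Fin 4, ((pat4 7 j = pat4 7 k) ∨ (pat4 7 j = pat4 7 u ∧ pat4 7 v = pat4 7 k) ∨
          (pat4 7 j = pat4 7 v ∧ pat4 7 u = pat4 7 k)) ↔ pat4 i j = pat4 i k) then cell (Function.update w s(p, q) 0) a b c y 7 else 0) +
      (if (∀ j k : Fin 4, ((pat4 8 j = pat4 8 k) ∨ (pat4 8 j = pat4 8 u ∧ pat4 8 v = pat4 8 k) ∨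
          (pat4 8 j = pat4 8 v ∧ pat4 8 u = pat4 8 k)) ↔ pat4 i j = pat4 i k) then cell (Function.update w s(p, q) 0) a b c y 8 else 0) +
      (if (∀ j k : Fin 4, ((pat4 9 j = pat4 9 k) ∨ (pat4 9 j = pat4 9 u ∧ pat4 9 v = pat4 9 k) ∨
          (pat4 9 j = pat4 9 v ∧ pat4 9 u = pat4 9 k)) ↔ pat4 i j = pat4 i k) then cell (Function.update w s(p, q) 0) a b c y 9 else 0) +
      (if (∀ j k : Fin 4, ((pat4 10 j = pat4 10 k) ∨ (pat4 10 j = pat4 10 u ∧ pat4 10 v = pat4 10 k) ∨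
          (pat4 10 j = pat4 10 v ∧ pat4 10 u = pat4 10 k)) ↔ pat4 i j = pat4 i k) then cell (Function.update w s(p, q) 0) a b c y 10 else 0) +
      (if (∀ j k : Fin 4, ((pat4 11 j = pat4 11 k) ∨ (pat4 11 j = pat4 11 u ∧ pat4 11 v = pat4 11 k) ∨
          (pat4 11 j = pat4 11 v ∧ pat4 11 u = pat4 11 k)) ↔ pat4 i j = pat4 i k) then cell (Function.update w s(p, q) 0) a b c y 11 else 0) +
      (if (∀ j k : Fin 4, ((pat4 12 j = pat4 12 k) ∨ (pat4 12 j = pat4 12 u ∧ pat4 12 v = pat4 12 k) ∨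
          (pat4 12 j = pat4 12 v ∧ pat4 12 u = pat4 12 k)) ↔ pat4 i j = pat4 i k) then cell (Function.update w s(p, q) 0) a b c y 12 else 0) +
      (if (∀ j k : Fin 4, ((pat4 13 j = pat4 13 k) ∨ (pat4 13 j = pat4 13 u ∧ pat4 13 v = pat4 13 k) ∨
          (pat4 13 j = pat4 13 v ∧ pat4 13 u = pat4 13 k)) ↔ pat4 i j = pat4 i k) then cell (Function.update w s(p, q) 0) a b c y 13 else 0) +
      (if (∀ j k : Fin 4, ((pat4 14 j = pat4 14 k) ∨ (pat4 14 j = pat4 14 u ∧ pat4 14 v = pat4 14 k) ∨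
          (pat4 14 j = pat4 14 v ∧ pat4 14 u = pat4 14 k)) ↔ pat4 i j = pat4 i k) then cell (Function.update w s(p, q) 0) a b c y 14 else 0) := by
  have glue : (prodBernoulli (Function.update w s(p, q) 1)).real (atom (quad a b c y) (pat4 i)) =
      (prodBernoulli (Function.update w s(p, q) 0)).real
        {ω : BondConfig (Fin n) | insert s(p, q) ω ∈ atom (quad a b c y) (pat4 i)} := by
    have h1 : Function.update w s(p, q) 1 = Function.update (Function.update w s(p, q) 0) s(p, q) 1 := by
      simp only [Function.update_idem]
    rw [h1]
    exact prodBernoulli_real_update_one_eq (TargetExploration.determinedBy_univ _) (Function.update w s(p, q) 0)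
      (Finset.mem_univ _)
  unfold cell
  rw [glue, measureReal_eq_cellSum (Function.update w s(p, q) 0) a b c y (hasPattern_insert' a b c y u v hp hq (pat4 i))]
  rfl

/-- Gladkov's three-point strong Harris–Kleitman (Aas–Gladkov) inequality for `(b,c,y)` in four-point cells:
`P(bc|y)P(by|c) + P(bc|y)P(b|cy) + P(by|c)P(b|cy) ≤ P(bcy)·P(b|c|y)`. [cite: Gladkov2024StrongFKG, Cor. 4.2] -/
private theorem sk3_bcy_cells' (w : Sym2 (Fin n) → unitInterval) (a b c y : Fin n) :
    (cell w a b c y 3 + cell w a b c y 8 + cell w a b c y 13) * (cell w a b c y 2 + cell w a b c y 9 + cell w a b c y 12) +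
        (cell w a b c y 3 + cell w a b c y 8 + cell w a b c y 13) * (cell w a b c y 1 + cell w a b c y 10 + cell w a b c y 11) +
        (cell w a b c y 2 + cell w a b c y 9 + cell w a b c y 12) * (cell w a b c y 1 + cell w a b c y 10 + cell w a b c y 11) ≤
      (cell w a b c y 7 + cell w a b c y 14) * (cell w a b c y 0 + cell w a b c y 4 + cell w a b c y 5 + cell w a b c y 6) := by
  have h := prodBernoulli_threePoint_strongHarris w b c y
  have e1 : (prodBernoulli w).real (openConn b c ∩ (openConn b y)ᶜ) = cell w a b c y 3 + cell w a b c y 8 + cell w a b c y 13 := by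
    rw [measureReal_eq_cellSum w a b c y (show HasPattern (quad a b c y) (openConn b c ∩ (openConn b y)ᶜ) _ from
      ((oc a b c y 1 2 rfl rfl).inter (oc a b c y 1 3 rfl rfl).compl))]
    simp (config := {decide := true}) only [ite_true, ite_false]; ring
  have e2 : (prodBernoulli w).real (openConn b y ∩ (openConn b c)ᶜ) = cell w a b c y 2 + cell w a b c y 9 + cell w a b c y 12 := by
    rw [measureReal_eq_cellSum w a b c y (show HasPattern (quad a b c y) (openConn b y ∩ (openConn b c)ᶜ) _ from
      ((oc a b c y 1 3 rfl rfl).inter (oc a b c y 1 2 rfl rfl).compl))]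
    simp (config := {decide := true}) only [ite_true, ite_false]; ring
  have e3 : (prodBernoulli w).real (openConn c y ∩ (openConn b c)ᶜ) = cell w a b c y 1 + cell w a b c y 10 + cell w a b c y 11 := by
    rw [measureReal_eq_cellSum w a b c y (show HasPattern (quad a b c y) (openConn c y ∩ (openConn b c)ᶜ) _ from
      ((oc a b c y 2 3 rfl rfl).inter (oc a b c y 1 2 rfl rfl).compl))]
    simp (config := {decide := true}) only [ite_true, ite_false]; ring
  have e4 : (prodBernoulli w).real (openConn b c ∩ openConn b y) = cell w a b c y 7 + cell w a b c y 14 := by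
    rw [measureReal_eq_cellSum w a b c y (show HasPattern (quad a b c y) (openConn b c ∩ openConn b y) _ from
      ((oc a b c y 1 2 rfl rfl).inter (oc a b c y 1 3 rfl rfl)))]
    simp (config := {decide := true}) only [ite_true, ite_false]; ring
  have e5 : (prodBernoulli w).real ((openConn b c)ᶜ ∩ (openConn b y)ᶜ ∩ (openConn c y)ᶜ) =
      cell w a b c y 0 + cell w a b c y 4 + cell w a b c y 5 + cell w a b c y 6 := by
    rw [measureReal_eq_cellSum w a b c y (show HasPattern (quad a b c y) ((openConn b c)ᶜ ∩ (openConn b y)ᶜ ∩ (openConn c y)ᶜ) _ from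
      (((oc a b c y 1 2 rfl rfl).compl.inter (oc a b c y 1 3 rfl rfl).compl).inter (oc a b c y 2 3 rfl rfl).compl))]
    simp (config := {decide := true}) only [ite_true, ite_false]; ring
  rw [e1, e2, e3, e4, e5] at h
  exact h

/-! ### The theorem -/

set_option linter.unusedSimpArgs false in
/-- **Conjecture W on the class "`a` attached only to terminals" — algebraic core (all `n`, all weights).**  Let
`w₀ = w[s(a,b)↦0][s(a,c)↦0][s(a,y)↦0]`.  If the ten cells of `w₀` in which `a` is joined to a terminal vanish (cells
`4,5,6,8,9,10,11,12,13,14` of `FourPointAtoms.pat4`), then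
`2(c₁₁c₉ + c₁₁c₈ + c₆c₈ + c₆c₁ + c₁c₈) + (c₂c₁₃ + c₁c₁₃ + c₅c₁₂ + c₁c₁₂ + c₆c₁₀ + c₆c₇ + c₂c₁₀ + c₅c₇) ≤ 2(c₁₁+c₁₄)c₀` for the cells of `w`
(the defect is `C_qx·SK3(b,c,y; w₀)` plus a sum of products of edge (non-)weights and two cells — three-port transfer). [this work] -/
theorem q44_cells_of_isolated_core (w : Sym2 (Fin n) → unitInterval) (a b c y : Fin n)
    (h4 : cell (Function.update (Function.update (Function.update w s(a, b) 0) s(a, c) 0) s(a, y) 0) a b c y 4 = 0)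
    (h5 : cell (Function.update (Function.update (Function.update w s(a, b) 0) s(a, c) 0) s(a, y) 0) a b c y 5 = 0)
    (h6 : cell (Function.update (Function.update (Function.update w s(a, b) 0) s(a, c) 0) s(a, y) 0) a b c y 6 = 0)
    (h8 : cell (Function.update (Function.update (Function.update w s(a, b) 0) s(a, c) 0) s(a, y) 0) a b c y 8 = 0)
    (h9 : cell (Function.update (Function.update (Function.update w s(a, b) 0) s(a, c) 0) s(a, y) 0) a b c y 9 = 0)
    (h10 : cell (Function.update (Function.update (Function.update w s(a, b) 0) s(a, c) 0) s(a, y) 0) a b c y 10 = 0)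
    (h11 : cell (Function.update (Function.update (Function.update w s(a, b) 0) s(a, c) 0) s(a, y) 0) a b c y 11 = 0)
    (h12 : cell (Function.update (Function.update (Function.update w s(a, b) 0) s(a, c) 0) s(a, y) 0) a b c y 12 = 0)
    (h13 : cell (Function.update (Function.update (Function.update w s(a, b) 0) s(a, c) 0) s(a, y) 0) a b c y 13 = 0)
    (h14 : cell (Function.update (Function.update (Function.update w s(a, b) 0) s(a, c) 0) s(a, y) 0) a b c y 14 = 0) :
    2 * (cell w a b c y 11 * cell w a b c y 9 + cell w a b c y 11 * cell w a b c y 8 + cell w a b c y 6 * cell w a b c y 8 + cell w a b c y 6 * cell w a b c y 1 + cell w a b c y 1 * cell w a b c y 8) +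
        (cell w a b c y 2 * cell w a b c y 13 + cell w a b c y 1 * cell w a b c y 13 + cell w a b c y 5 * cell w a b c y 12 + cell w a b c y 1 * cell w a b c y 12 + cell w a b c y 6 * cell w a b c y 10 + cell w a b c y 6 * cell w a b c y 7 +
          cell w a b c y 2 * cell w a b c y 10 + cell w a b c y 5 * cell w a b c y 7) ≤
      2 * ((cell w a b c y 11 + cell w a b c y 14) * cell w a b c y 0) := by
  -- cells of w₂ = w[ab↦0][ac↦0] from the five live cells of w₀ (pair s(a,y), parameter γ = w₂ s(a,y))
  have c3_0 : cell (Function.update (Function.update w s(a, b) 0) s(a, c) 0) a b c y 0 = cell (Function.update (Function.update (Function.update w s(a, b) 0) s(a, c) 0) s(a, y) 0) a b c y 0 - ((Function.update (Function.update w s(a, b) 0) s(a, c) 0) s(a, y) : ℝ) * cell (Function.update (Function.update (Function.update w s(a, b) 0) s(a, c) 0) s(a, y) 0) a b c y 0 := by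
    have h := cell_update_one' (Function.update (Function.update w s(a, b) 0) s(a, c) 0) a b c y 0 3 (p := a) (q := y) rfl rfl 0; simp (config := {decide := true}) only [ite_true, ite_false, add_zero, zero_add] at h
    rw [SingleSourceLaw.cell_oneBond (Function.update (Function.update w s(a, b) 0) s(a, c) 0) s(a, y) a b c y 0, h]; ring
  have c3_1 : cell (Function.update (Function.update w s(a, b) 0) s(a, c) 0) a b c y 1 = cell (Function.update (Function.update (Function.update w s(a, b) 0) s(a, c) 0) s(a, y) 0) a b c y 1 - ((Function.update (Function.update w s(a, b) 0) s(a, c) 0) s(a, y) : ℝ) * cell (Function.update (Function.update (Function.update w s(a, b) 0) s(a, c) 0) s(a, y) 0) a b c y 1 := by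
    have h := cell_update_one' (Function.update (Function.update w s(a, b) 0) s(a, c) 0) a b c y 0 3 (p := a) (q := y) rfl rfl 1; simp (config := {decide := true}) only [ite_true, ite_false, add_zero, zero_add] at h
    rw [SingleSourceLaw.cell_oneBond (Function.update (Function.update w s(a, b) 0) s(a, c) 0) s(a, y) a b c y 1, h]; ring
  have c3_2 : cell (Function.update (Function.update w s(a, b) 0) s(a, c) 0) a b c y 2 = cell (Function.update (Function.update (Function.update w s(a, b) 0) s(a, c) 0) s(a, y) 0) a b c y 2 - ((Function.update (Function.update w s(a, b) 0) s(a, c) 0) s(a, y) : ℝ) * cell (Function.update (Function.update (Function.update w s(a, b) 0) s(a, c) 0) s(a, y) 0) a b c y 2 := by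
    have h := cell_update_one' (Function.update (Function.update w s(a, b) 0) s(a, c) 0) a b c y 0 3 (p := a) (q := y) rfl rfl 2; simp (config := {decide := true}) only [ite_true, ite_false, add_zero, zero_add] at h
    rw [SingleSourceLaw.cell_oneBond (Function.update (Function.update w s(a, b) 0) s(a, c) 0) s(a, y) a b c y 2, h]; ring
  have c3_3 : cell (Function.update (Function.update w s(a, b) 0) s(a, c) 0) a b c y 3 = cell (Function.update (Function.update (Function.update w s(a, b) 0) s(a, c) 0) s(a, y) 0) a b c y 3 - ((Function.update (Function.update w s(a, b) 0) s(a, c) 0) s(a, y) : ℝ) * cell (Function.update (Function.update (Function.update w s(a, b) 0) s(a, c) 0) s(a, y) 0) a b c y 3 := by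
    have h := cell_update_one' (Function.update (Function.update w s(a, b) 0) s(a, c) 0) a b c y 0 3 (p := a) (q := y) rfl rfl 3; simp (config := {decide := true}) only [ite_true, ite_false, add_zero, zero_add] at h
    rw [SingleSourceLaw.cell_oneBond (Function.update (Function.update w s(a, b) 0) s(a, c) 0) s(a, y) a b c y 3, h]; ring
  have c3_4 : cell (Function.update (Function.update w s(a, b) 0) s(a, c) 0) a b c y 4 = ((Function.update (Function.update w s(a, b) 0) s(a, c) 0) s(a, y) : ℝ) * cell (Function.update (Function.update (Function.update w s(a, b) 0) s(a, c) 0) s(a, y) 0) a b c y 0 := by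
    have h := cell_update_one' (Function.update (Function.update w s(a, b) 0) s(a, c) 0) a b c y 0 3 (p := a) (q := y) rfl rfl 4; simp (config := {decide := true}) only [ite_true, ite_false, add_zero, zero_add] at h
    rw [SingleSourceLaw.cell_oneBond (Function.update (Function.update w s(a, b) 0) s(a, c) 0) s(a, y) a b c y 4, h]; simp only [h4, h5, h6, h8, h9, h10, h11, h12, h13, h14]; ring
  have c3_5 : cell (Function.update (Function.update w s(a, b) 0) s(a, c) 0) a b c y 5 = 0 := by
    have h := cell_update_one' (Function.update (Function.update w s(a, b) 0) s(a, c) 0) a b c y 0 3 (p := a) (q := y) rfl rfl 5; simp (config := {decide := true}) only [ite_true, ite_false, add_zero, zero_add] at h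
    rw [SingleSourceLaw.cell_oneBond (Function.update (Function.update w s(a, b) 0) s(a, c) 0) s(a, y) a b c y 5, h]; simp only [h4, h5, h6, h8, h9, h10, h11, h12, h13, h14]; ring
  have c3_6 : cell (Function.update (Function.update w s(a, b) 0) s(a, c) 0) a b c y 6 = 0 := by
    have h := cell_update_one' (Function.update (Function.update w s(a, b) 0) s(a, c) 0) a b c y 0 3 (p := a) (q := y) rfl rfl 6; simp (config := {decide := true}) only [ite_true, ite_false, add_zero, zero_add] at h
    rw [SingleSourceLaw.cell_oneBond (Function.update (Function.update w s(a, b) 0) s(a, c) 0) s(a, y) a b c y 6, h]; simp only [h4, h5, h6, h8, h9, h10, h11, h12, h13, h14]; ring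
  have c3_7 : cell (Function.update (Function.update w s(a, b) 0) s(a, c) 0) a b c y 7 = cell (Function.update (Function.update (Function.update w s(a, b) 0) s(a, c) 0) s(a, y) 0) a b c y 7 - ((Function.update (Function.update w s(a, b) 0) s(a, c) 0) s(a, y) : ℝ) * cell (Function.update (Function.update (Function.update w s(a, b) 0) s(a, c) 0) s(a, y) 0) a b c y 7 := by
    have h := cell_update_one' (Function.update (Function.update w s(a, b) 0) s(a, c) 0) a b c y 0 3 (p := a) (q := y) rfl rfl 7; simp (config := {decide := true}) only [ite_true, ite_false, add_zero, zero_add] at h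
    rw [SingleSourceLaw.cell_oneBond (Function.update (Function.update w s(a, b) 0) s(a, c) 0) s(a, y) a b c y 7, h]; ring
  have c3_8 : cell (Function.update (Function.update w s(a, b) 0) s(a, c) 0) a b c y 8 = ((Function.update (Function.update w s(a, b) 0) s(a, c) 0) s(a, y) : ℝ) * cell (Function.update (Function.update (Function.update w s(a, b) 0) s(a, c) 0) s(a, y) 0) a b c y 3 := by
    have h := cell_update_one' (Function.update (Function.update w s(a, b) 0) s(a, c) 0) a b c y 0 3 (p := a) (q := y) rfl rfl 8; simp (config := {decide := true}) only [ite_true, ite_false, add_zero, zero_add] at h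
    rw [SingleSourceLaw.cell_oneBond (Function.update (Function.update w s(a, b) 0) s(a, c) 0) s(a, y) a b c y 8, h]; simp only [h4, h5, h6, h8, h9, h10, h11, h12, h13, h14]; ring
  have c3_9 : cell (Function.update (Function.update w s(a, b) 0) s(a, c) 0) a b c y 9 = 0 := by
    have h := cell_update_one' (Function.update (Function.update w s(a, b) 0) s(a, c) 0) a b c y 0 3 (p := a) (q := y) rfl rfl 9; simp (config := {decide := true}) only [ite_true, ite_false, add_zero, zero_add] at h
    rw [SingleSourceLaw.cell_oneBond (Function.update (Function.update w s(a, b) 0) s(a, c) 0) s(a, y) a b c y 9, h]; simp only [h4, h5, h6, h8, h9, h10, h11, h12, h13, h14]; ring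
  have c3_10 : cell (Function.update (Function.update w s(a, b) 0) s(a, c) 0) a b c y 10 = ((Function.update (Function.update w s(a, b) 0) s(a, c) 0) s(a, y) : ℝ) * cell (Function.update (Function.update (Function.update w s(a, b) 0) s(a, c) 0) s(a, y) 0) a b c y 1 := by
    have h := cell_update_one' (Function.update (Function.update w s(a, b) 0) s(a, c) 0) a b c y 0 3 (p := a) (q := y) rfl rfl 10; simp (config := {decide := true}) only [ite_true, ite_false, add_zero, zero_add] at h
    rw [SingleSourceLaw.cell_oneBond (Function.update (Function.update w s(a, b) 0) s(a, c) 0) s(a, y) a b c y 10, h]; simp only [h4, h5, h6, h8, h9, h10, h11, h12, h13, h14]; ring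
  have c3_11 : cell (Function.update (Function.update w s(a, b) 0) s(a, c) 0) a b c y 11 = 0 := by
    have h := cell_update_one' (Function.update (Function.update w s(a, b) 0) s(a, c) 0) a b c y 0 3 (p := a) (q := y) rfl rfl 11; simp (config := {decide := true}) only [ite_true, ite_false, add_zero, zero_add] at h
    rw [SingleSourceLaw.cell_oneBond (Function.update (Function.update w s(a, b) 0) s(a, c) 0) s(a, y) a b c y 11, h]; simp only [h4, h5, h6, h8, h9, h10, h11, h12, h13, h14]; ring
  have c3_12 : cell (Function.update (Function.update w s(a, b) 0) s(a, c) 0) a b c y 12 = ((Function.update (Function.update w s(a, b) 0) s(a, c) 0) s(a, y) : ℝ) * cell (Function.update (Function.update (Function.update w s(a, b) 0) s(a, c) 0) s(a, y) 0) a b c y 2 := by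
    have h := cell_update_one' (Function.update (Function.update w s(a, b) 0) s(a, c) 0) a b c y 0 3 (p := a) (q := y) rfl rfl 12; simp (config := {decide := true}) only [ite_true, ite_false, add_zero, zero_add] at h
    rw [SingleSourceLaw.cell_oneBond (Function.update (Function.update w s(a, b) 0) s(a, c) 0) s(a, y) a b c y 12, h]; simp only [h4, h5, h6, h8, h9, h10, h11, h12, h13, h14]; ring
  have c3_13 : cell (Function.update (Function.update w s(a, b) 0) s(a, c) 0) a b c y 13 = 0 := by
    have h := cell_update_one' (Function.update (Function.update w s(a, b) 0) s(a, c) 0) a b c y 0 3 (p := a) (q := y) rfl rfl 13; simp (config := {decide := true}) only [ite_true, ite_false, add_zero, zero_add] at h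
    rw [SingleSourceLaw.cell_oneBond (Function.update (Function.update w s(a, b) 0) s(a, c) 0) s(a, y) a b c y 13, h]; simp only [h4, h5, h6, h8, h9, h10, h11, h12, h13, h14]; ring
  have c3_14 : cell (Function.update (Function.update w s(a, b) 0) s(a, c) 0) a b c y 14 = ((Function.update (Function.update w s(a, b) 0) s(a, c) 0) s(a, y) : ℝ) * cell (Function.update (Function.update (Function.update w s(a, b) 0) s(a, c) 0) s(a, y) 0) a b c y 7 := by
    have h := cell_update_one' (Function.update (Function.update w s(a, b) 0) s(a, c) 0) a b c y 0 3 (p := a) (q := y) rfl rfl 14; simp (config := {decide := true}) only [ite_true, ite_false, add_zero, zero_add] at h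
    rw [SingleSourceLaw.cell_oneBond (Function.update (Function.update w s(a, b) 0) s(a, c) 0) s(a, y) a b c y 14, h]; simp only [h4, h5, h6, h8, h9, h10, h11, h12, h13, h14]; ring
  -- cells of w₁ = w[ab↦0] from the cells of w₂ (pair s(a,c), parameter β = w₁ s(a,c))
  have c2_0 : cell (Function.update w s(a, b) 0) a b c y 0 = cell (Function.update (Function.update (Function.update w s(a, b) 0) s(a, c) 0) s(a, y) 0) a b c y 0 - ((Function.update (Function.update w s(a, b) 0) s(a, c) 0) s(a, y) : ℝ) * cell (Function.update (Function.update (Function.update w s(a, b) 0) s(a, c) 0) s(a, y) 0) a b c y 0 - ((Function.update w s(a, b) 0) s(a, c) : ℝ) * cell (Function.update (Function.update (Function.update w s(a, b) 0) s(a, c) 0) s(a, y) 0) a b c y 0 + ((Function.update w s(a, b) 0) s(a, c) : ℝ) * ((Function.update (Function.update w s(a, b) 0) s(a, c) 0) s(a, y) : ℝ) * cell (Function.update (Function.update (Function.update w s(a, b) 0) s(a, c) 0) s(a, y) 0) a b c y 0 := by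
    have h := cell_update_one' (Function.update w s(a, b) 0) a b c y 0 2 (p := a) (q := c) rfl rfl 0; simp (config := {decide := true}) only [ite_true, ite_false, add_zero, zero_add] at h
    rw [SingleSourceLaw.cell_oneBond (Function.update w s(a, b) 0) s(a, c) a b c y 0, h]; simp only [c3_0, c3_1, c3_2, c3_3, c3_4, c3_5, c3_6, c3_7, c3_8, c3_9, c3_10, c3_11, c3_12, c3_13, c3_14]; ring
  have c2_1 : cell (Function.update w s(a, b) 0) a b c y 1 = cell (Function.update (Function.update (Function.update w s(a, b) 0) s(a, c) 0) s(a, y) 0) a b c y 1 - ((Function.update (Function.update w s(a, b) 0) s(a, c) 0) s(a, y) : ℝ) * cell (Function.update (Function.update (Function.update w s(a, b) 0) s(a, c) 0) s(a, y) 0) a b c y 1 - ((Function.update w s(a, b) 0) s(a, c) : ℝ) * cell (Function.update (Function.update (Function.update w s(a, b) 0) s(a, c) 0) s(a, y) 0) a b c y 1 + ((Function.update w s(a, b) 0) s(a, c) : ℝ) * ((Function.update (Function.update w s(a, b) 0) s(a, c) 0) s(a, y) : ℝ) * cell (Function.update (Function.update (Function.update w s(a, b) 0) s(a, c) 0) s(a,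 y) 0) a b c y 1 := by
    have h := cell_update_one' (Function.update w s(a, b) 0) a b c y 0 2 (p := a) (q := c) rfl rfl 1; simp (config := {decide := true}) only [ite_true, ite_false, add_zero, zero_add] at h
    rw [SingleSourceLaw.cell_oneBond (Function.update w s(a, b) 0) s(a, c) a b c y 1, h]; simp only [c3_0, c3_1, c3_2, c3_3, c3_4, c3_5, c3_6, c3_7, c3_8, c3_9, c3_10, c3_11, c3_12, c3_13, c3_14]; ring
  have c2_2 : cell (Function.update w s(a, b) 0) a b c y 2 = cell (Function.update (Function.update (Function.update w s(a, b) 0) s(a, c) 0) s(a, y) 0) a b c y 2 - ((Function.update (Function.update w s(a, b) 0) s(a, c) 0) s(a, y) : ℝ) * cell (Function.update (Function.update (Function.update w s(a, b) 0) s(a, c) 0) s(a, y) 0) a b c y 2 - ((Function.update w s(a, b) 0) s(a, c) : ℝ) * cell (Function.update (Function.update (Function.update w s(a, b) 0) s(a, c) 0) s(a, y) 0) a b c y 2 + ((Function.update w s(a, b) 0) s(a, c) : ℝ) * ((Function.update (Function.update w s(a, b) 0) s(a, c) 0) s(a, y) : ℝ) * cell (Function.update (Function.update (Function.update w s(a,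 b) 0) s(a, c) 0) s(a, y) 0) a b c y 2 := by
    have h := cell_update_one' (Function.update w s(a, b) 0) a b c y 0 2 (p := a) (q := c) rfl rfl 2; simp (config := {decide := true}) only [ite_true, ite_false, add_zero, zero_add] at h
    rw [SingleSourceLaw.cell_oneBond (Function.update w s(a, b) 0) s(a, c) a b c y 2, h]; simp only [c3_0, c3_1, c3_2, c3_3, c3_4, c3_5, c3_6, c3_7, c3_8, c3_9, c3_10, c3_11, c3_12, c3_13, c3_14]; ring
  have c2_3 : cell (Function.update w s(a, b) 0) a b c y 3 = cell (Function.update (Function.update (Function.update w s(a, b) 0) s(a, c) 0) s(a, y) 0) a b c y 3 - ((Function.update (Function.update w s(a, b) 0) s(a, c) 0) s(a, y) : ℝ) * cell (Function.update (Function.update (Function.update w s(a, b) 0) s(a, c) 0) s(a, y) 0) a b c y 3 - ((Function.update w s(a, b) 0) s(a, c) : ℝ) * cell (Function.update (Function.update (Function.update w s(a, b) 0) s(a, c) 0) s(a, y) 0) a b c y 3 + ((Function.update w s(a, b) 0) s(a, c) : ℝ) * ((Function.update (Function.update w s(a, b) 0) s(a, c) 0) s(a, y) : ℝ) * cell (Function.update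 (Function.update (Function.update w s(a, b) 0) s(a, c) 0) s(a, y) 0) a b c y 3 := by
    have h := cell_update_one' (Function.update w s(a, b) 0) a b c y 0 2 (p := a) (q := c) rfl rfl 3; simp (config := {decide := true}) only [ite_true, ite_false, add_zero, zero_add] at h
    rw [SingleSourceLaw.cell_oneBond (Function.update w s(a, b) 0) s(a, c) a b c y 3, h]; simp only [c3_0, c3_1, c3_2, c3_3, c3_4, c3_5, c3_6, c3_7, c3_8, c3_9, c3_10, c3_11, c3_12, c3_13, c3_14]; ring
  have c2_4 : cell (Function.update w s(a, b) 0) a b c y 4 = ((Function.update (Function.update w s(a, b) 0) s(a, c) 0) s(a, y) : ℝ) * cell (Function.update (Function.update (Function.update w s(a, b) 0) s(a, c) 0) s(a, y) 0) a b c y 0 - ((Function.update w s(a, b) 0) s(a, c) : ℝ) * ((Function.update (Function.update w s(a, b) 0) s(a, c) 0) s(a, y) : ℝ) * cell (Function.update (Function.update (Function.update w s(a, b) 0) s(a, c) 0) s(a, y) 0) a b c y 0 := by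
    have h := cell_update_one' (Function.update w s(a, b) 0) a b c y 0 2 (p := a) (q := c) rfl rfl 4; simp (config := {decide := true}) only [ite_true, ite_false, add_zero, zero_add] at h
    rw [SingleSourceLaw.cell_oneBond (Function.update w s(a, b) 0) s(a, c) a b c y 4, h]; simp only [c3_0, c3_1, c3_2, c3_3, c3_4, c3_5, c3_6, c3_7, c3_8, c3_9, c3_10, c3_11, c3_12, c3_13, c3_14]; ring
  have c2_5 : cell (Function.update w s(a, b) 0) a b c y 5 = ((Function.update w s(a, b) 0) s(a, c) : ℝ) * cell (Function.update (Function.update (Function.update w s(a, b) 0) s(a, c) 0) s(a, y) 0) a b c y 0 - ((Function.update w s(a, b) 0) s(a, c) : ℝ) * ((Function.update (Function.update w s(a, b) 0) s(a, c) 0) s(a, y) : ℝ) * cell (Function.update (Function.update (Function.update w s(a, b) 0) s(a, c) 0) s(a, y) 0) a b c y 0 := by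
    have h := cell_update_one' (Function.update w s(a, b) 0) a b c y 0 2 (p := a) (q := c) rfl rfl 5; simp (config := {decide := true}) only [ite_true, ite_false, add_zero, zero_add] at h
    rw [SingleSourceLaw.cell_oneBond (Function.update w s(a, b) 0) s(a, c) a b c y 5, h]; simp only [c3_0, c3_1, c3_2, c3_3, c3_4, c3_5, c3_6, c3_7, c3_8, c3_9, c3_10, c3_11, c3_12, c3_13, c3_14]; ring
  have c2_6 : cell (Function.update w s(a, b) 0) a b c y 6 = 0 := by
    have h := cell_update_one' (Function.update w s(a, b) 0) a b c y 0 2 (p := a) (q := c) rfl rfl 6; simp (config := {decide := true}) only [ite_true, ite_false, add_zero, zero_add] at h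
    rw [SingleSourceLaw.cell_oneBond (Function.update w s(a, b) 0) s(a, c) a b c y 6, h]; simp only [c3_0, c3_1, c3_2, c3_3, c3_4, c3_5, c3_6, c3_7, c3_8, c3_9, c3_10, c3_11, c3_12, c3_13, c3_14]; ring
  have c2_7 : cell (Function.update w s(a, b) 0) a b c y 7 = cell (Function.update (Function.update (Function.update w s(a, b) 0) s(a, c) 0) s(a, y) 0) a b c y 7 - ((Function.update (Function.update w s(a, b) 0) s(a, c) 0) s(a, y) : ℝ) * cell (Function.update (Function.update (Function.update w s(a, b) 0) s(a, c) 0) s(a, y) 0) a b c y 7 - ((Function.update w s(a, b) 0) s(a, c) : ℝ) * cell (Function.update (Function.update (Function.update w s(a, b) 0) s(a, c) 0) s(a, y) 0) a b c y 7 + ((Function.update w s(a, b) 0) s(a, c) : ℝ) * ((Function.update (Function.update w s(a, b) 0) s(a, c) 0) s(a, y) : ℝ) * cell (Function.update (Function.update (Function.update w s(a, b) 0) s(a, c) 0) s(a, y) 0) a b c y 7 := by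
    have h := cell_update_one' (Function.update w s(a, b) 0) a b c y 0 2 (p := a) (q := c) rfl rfl 7; simp (config := {decide := true}) only [ite_true, ite_false, add_zero, zero_add] at h
    rw [SingleSourceLaw.cell_oneBond (Function.update w s(a, b) 0) s(a, c) a b c y 7, h]; simp only [c3_0, c3_1, c3_2, c3_3, c3_4, c3_5, c3_6, c3_7, c3_8, c3_9, c3_10, c3_11, c3_12, c3_13, c3_14]; ring
  have c2_8 : cell (Function.update w s(a, b) 0) a b c y 8 = ((Function.update (Function.update w s(a, b) 0) s(a, c) 0) s(a, y) : ℝ) * cell (Function.update (Function.update (Function.update w s(a, b) 0) s(a, c) 0) s(a, y) 0) a b c y 3 - ((Function.update w s(a, b) 0) s(a, c) : ℝ) * ((Function.update (Function.update w s(a, b) 0) s(a, c) 0) s(a, y) : ℝ) * cell (Function.update (Function.update (Function.update w s(a, b) 0) s(a, c) 0) s(a, y) 0) a b c y 3 := by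
    have h := cell_update_one' (Function.update w s(a, b) 0) a b c y 0 2 (p := a) (q := c) rfl rfl 8; simp (config := {decide := true}) only [ite_true, ite_false, add_zero, zero_add] at h
    rw [SingleSourceLaw.cell_oneBond (Function.update w s(a, b) 0) s(a, c) a b c y 8, h]; simp only [c3_0, c3_1, c3_2, c3_3, c3_4, c3_5, c3_6, c3_7, c3_8, c3_9, c3_10, c3_11, c3_12, c3_13, c3_14]; ring
  have c2_9 : cell (Function.update w s(a, b) 0) a b c y 9 = ((Function.update w s(a, b) 0) s(a, c) : ℝ) * cell (Function.update (Function.update (Function.update w s(a, b) 0) s(a, c) 0) s(a, y) 0) a b c y 2 - ((Function.update w s(a, b) 0) s(a, c) : ℝ) * ((Function.update (Function.update w s(a, b) 0) s(a, c) 0) s(a, y) : ℝ) * cell (Function.update (Function.update (Function.update w s(a, b) 0) s(a, c) 0) s(a, y) 0) a b c y 2 := by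
    have h := cell_update_one' (Function.update w s(a, b) 0) a b c y 0 2 (p := a) (q := c) rfl rfl 9; simp (config := {decide := true}) only [ite_true, ite_false, add_zero, zero_add] at h
    rw [SingleSourceLaw.cell_oneBond (Function.update w s(a, b) 0) s(a, c) a b c y 9, h]; simp only [c3_0, c3_1, c3_2, c3_3, c3_4, c3_5, c3_6, c3_7, c3_8, c3_9, c3_10, c3_11, c3_12, c3_13, c3_14]; ring
  have c2_10 : cell (Function.update w s(a, b) 0) a b c y 10 = ((Function.update (Function.update w s(a, b) 0) s(a, c) 0) s(a, y) : ℝ) * cell (Function.update (Function.update (Function.update w s(a, b) 0) s(a, c) 0) s(a, y) 0) a b c y 1 + ((Function.update w s(a, b) 0) s(a, c) : ℝ) * cell (Function.update (Function.update (Function.update w s(a, b) 0) s(a, c) 0) s(a, y) 0) a b c y 1 - ((Function.update w s(a, b) 0) s(a, c) : ℝ) * ((Function.update (Function.update w s(a, b) 0) s(a, c) 0) s(a, y) : ℝ) * cell (Function.update (Function.update (Function.update w s(a, b) 0) s(a, c) 0) s(a, y) 0) a b c y 1 + ((Function.update w s(a, b) 0) s(a, c) : ℝ) * ((Function.update (Function.update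 w s(a, b) 0) s(a, c) 0) s(a, y) : ℝ) * cell (Function.update (Function.update (Function.update w s(a, b) 0) s(a, c) 0) s(a, y) 0) a b c y 0 := by
    have h := cell_update_one' (Function.update w s(a, b) 0) a b c y 0 2 (p := a) (q := c) rfl rfl 10; simp (config := {decide := true}) only [ite_true, ite_false, add_zero, zero_add] at h
    rw [SingleSourceLaw.cell_oneBond (Function.update w s(a, b) 0) s(a, c) a b c y 10, h]; simp only [c3_0, c3_1, c3_2, c3_3, c3_4, c3_5, c3_6, c3_7, c3_8, c3_9, c3_10, c3_11, c3_12, c3_13, c3_14]; ring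
  have c2_11 : cell (Function.update w s(a, b) 0) a b c y 11 = 0 := by
    have h := cell_update_one' (Function.update w s(a, b) 0) a b c y 0 2 (p := a) (q := c) rfl rfl 11; simp (config := {decide := true}) only [ite_true, ite_false, add_zero, zero_add] at h
    rw [SingleSourceLaw.cell_oneBond (Function.update w s(a, b) 0) s(a, c) a b c y 11, h]; simp only [c3_0, c3_1, c3_2, c3_3, c3_4, c3_5, c3_6, c3_7, c3_8, c3_9, c3_10, c3_11, c3_12, c3_13, c3_14]; ring
  have c2_12 : cell (Function.update w s(a, b) 0) a b c y 12 = ((Function.update (Function.update w s(a, b) 0) s(a, c) 0) s(a, y) : ℝ) * cell (Function.update (Function.update (Function.update w s(a, b) 0) s(a, c) 0) s(a, y) 0) a b c y 2 - ((Function.update w s(a, b) 0) s(a, c) : ℝ) * ((Function.update (Function.update w s(a, b) 0) s(a, c) 0) s(a, y) : ℝ) * cell (Function.update (Function.update (Function.update w s(a, b) 0) s(a, c) 0) s(a, y) 0) a b c y 2 := by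
    have h := cell_update_one' (Function.update w s(a, b) 0) a b c y 0 2 (p := a) (q := c) rfl rfl 12; simp (config := {decide := true}) only [ite_true, ite_false, add_zero, zero_add] at h
    rw [SingleSourceLaw.cell_oneBond (Function.update w s(a, b) 0) s(a, c) a b c y 12, h]; simp only [c3_0, c3_1, c3_2, c3_3, c3_4, c3_5, c3_6, c3_7, c3_8, c3_9, c3_10, c3_11, c3_12, c3_13, c3_14]; ring
  have c2_13 : cell (Function.update w s(a, b) 0) a b c y 13 = ((Function.update w s(a, b) 0) s(a, c) : ℝ) * cell (Function.update (Function.update (Function.update w s(a, b) 0) s(a, c) 0) s(a, y) 0) a b c y 3 - ((Function.update w s(a, b) 0) s(a, c) : ℝ) * ((Function.update (Function.update w s(a, b) 0) s(a, c) 0) s(a, y) : ℝ) * cell (Function.update (Function.update (Function.update w s(a, b) 0) s(a, c) 0) s(a, y) 0) a b c y 3 := by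
    have h := cell_update_one' (Function.update w s(a, b) 0) a b c y 0 2 (p := a) (q := c) rfl rfl 13; simp (config := {decide := true}) only [ite_true, ite_false, add_zero, zero_add] at h
    rw [SingleSourceLaw.cell_oneBond (Function.update w s(a, b) 0) s(a, c) a b c y 13, h]; simp only [c3_0, c3_1, c3_2, c3_3, c3_4, c3_5, c3_6, c3_7, c3_8, c3_9, c3_10, c3_11, c3_12, c3_13, c3_14]; ring
  have c2_14 : cell (Function.update w s(a, b) 0) a b c y 14 = ((Function.update (Function.update w s(a, b) 0) s(a, c) 0) s(a, y) : ℝ) * cell (Function.update (Function.update (Function.update w s(a, b) 0) s(a, c) 0) s(a, y) 0) a b c y 7 + ((Function.update w s(a, b) 0) s(a, c) : ℝ) * cell (Function.update (Function.update (Function.update w s(a, b) 0) s(a, c) 0) s(a, y) 0) a b c y 7 - ((Function.update w s(a, b) 0) s(a, c) : ℝ) * ((Function.update (Function.update w s(a, b) 0) s(a, c) 0) s(a, y) : ℝ) * cell (Function.update (Function.update (Function.update w s(a, b) 0) s(a, c) 0) s(a, y) 0) a b c y 7 + ((Function.update w s(a, b) 0) s(a, c) : ℝ) * ((Function.update (Function.update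 w s(a, b) 0) s(a, c) 0) s(a, y) : ℝ) * cell (Function.update (Function.update (Function.update w s(a, b) 0) s(a, c) 0) s(a, y) 0) a b c y 3 + ((Function.update w s(a, b) 0) s(a, c) : ℝ) * ((Function.update (Function.update w s(a, b) 0) s(a, c) 0) s(a, y) : ℝ) * cell (Function.update (Function.update (Function.update w s(a, b) 0) s(a, c) 0) s(a, y) 0) a b c y 2 := by
    have h := cell_update_one' (Function.update w s(a, b) 0) a b c y 0 2 (p := a) (q := c) rfl rfl 14; simp (config := {decide := true}) only [ite_true, ite_false, add_zero, zero_add] at h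
    rw [SingleSourceLaw.cell_oneBond (Function.update w s(a, b) 0) s(a, c) a b c y 14, h]; simp only [c3_0, c3_1, c3_2, c3_3, c3_4, c3_5, c3_6, c3_7, c3_8, c3_9, c3_10, c3_11, c3_12, c3_13, c3_14]; ring
  -- cells of w from the cells of w₁ (pair s(a,b), parameter α = w s(a,b))
  have c1_0 : cell w a b c y 0 = cell (Function.update (Function.update (Function.update w s(a, b) 0) s(a, c) 0) s(a, y) 0) a b c y 0 - ((Function.update (Function.update w s(a, b) 0) s(a, c) 0) s(a, y) : ℝ) * cell (Function.update (Function.update (Function.update w s(a, b) 0) s(a, c) 0) s(a, y) 0) a b c y 0 - ((Function.update w s(a, b) 0) s(a, c) : ℝ) * cell (Function.update (Function.update (Function.update w s(a, b) 0) s(a, c) 0) s(a, y) 0) a b c y 0 + ((Function.update w s(a, b) 0) s(a, c) : ℝ) * ((Function.update (Function.update w s(a, b) 0) s(a, c) 0) s(a, y) : ℝ) * cell (Function.update (Function.update (Function.update w s(a, b) 0) s(a, c) 0) s(a, y) 0) a b c y 0 - (w s(a, b) : ℝ) * cell (Function.update (Function.update (Function.update w s(a, b) 0) s(a, c) 0)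 s(a, y) 0) a b c y 0 + (w s(a, b) : ℝ) * ((Function.update (Function.update w s(a, b) 0) s(a, c) 0) s(a, y) : ℝ) * cell (Function.update (Function.update (Function.update w s(a, b) 0) s(a, c) 0) s(a, y) 0) a b c y 0 + (w s(a, b) : ℝ) * ((Function.update w s(a, b) 0) s(a, c) : ℝ) * cell (Function.update (Function.update (Function.update w s(a, b) 0) s(a, c) 0) s(a, y) 0) a b c y 0 - (w s(a, b) : ℝ) * ((Function.update w s(a, b) 0) s(a, c) : ℝ) * ((Function.update (Function.update w s(a, b) 0) s(a, c) 0) s(a, y) : ℝ) * cell (Function.update (Function.update (Function.update w s(a, b) 0) s(a, c) 0) s(a, y) 0) a b c y 0 := by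
    have h := cell_update_one' w a b c y 0 1 (p := a) (q := b) rfl rfl 0; simp (config := {decide := true}) only [ite_true, ite_false, add_zero, zero_add] at h
    rw [SingleSourceLaw.cell_oneBond w s(a, b) a b c y 0, h]; simp only [c2_0, c2_1, c2_2, c2_3, c2_4, c2_5, c2_6, c2_7, c2_8, c2_9, c2_10, c2_11, c2_12, c2_13, c2_14]; ring
  have c1_1 : cell w a b c y 1 = cell (Function.update (Function.update (Function.update w s(a, b) 0) s(a, c) 0) s(a, y) 0) a b c y 1 - ((Function.update (Function.update w s(a, b) 0) s(a, c) 0) s(a, y) : ℝ) * cell (Function.update (Function.update (Function.update w s(a, b) 0) s(a, c) 0) s(a, y) 0) a b c y 1 - ((Function.update w s(a, b) 0) s(a, c) : ℝ) * cell (Function.update (Function.update (Function.update w s(a, b) 0) s(a, c) 0) s(a, y) 0) a b c y 1 + ((Function.update w s(a, b) 0) s(a, c) : ℝ) * ((Function.update (Function.update w s(a, b) 0) s(a, c) 0) s(a, y) : ℝ) * cell (Function.update (Function.update (Function.update w s(a, b) 0) s(a, c) 0) s(a, y) 0) a b c y 1 - (w s(a, b) : ℝ) * cell (Function.update (Function.update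 (Function.update w s(a, b) 0) s(a, c) 0) s(a, y) 0) a b c y 1 + (w s(a, b) : ℝ) * ((Function.update (Function.update w s(a, b) 0) s(a, c) 0) s(a, y) : ℝ) * cell (Function.update (Function.update (Function.update w s(a, b) 0) s(a, c) 0) s(a, y) 0) a b c y 1 + (w s(a, b) : ℝ) * ((Function.update w s(a, b) 0) s(a, c) : ℝ) * cell (Function.update (Function.update (Function.update w s(a, b) 0) s(a, c) 0) s(a, y) 0) a b c y 1 - (w s(a, b) : ℝ) * ((Function.update w s(a, b) 0) s(a, c) : ℝ) * ((Function.update (Function.update w s(a, b) 0) s(a, c) 0) s(a, y) : ℝ) * cell (Function.update (Function.update (Function.update w s(a, b) 0) s(a, c) 0) s(a, y) 0) a b c y 1 := by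
    have h := cell_update_one' w a b c y 0 1 (p := a) (q := b) rfl rfl 1; simp (config := {decide := true}) only [ite_true, ite_false, add_zero, zero_add] at h
    rw [SingleSourceLaw.cell_oneBond w s(a, b) a b c y 1, h]; simp only [c2_0, c2_1, c2_2, c2_3, c2_4, c2_5, c2_6, c2_7, c2_8, c2_9, c2_10, c2_11, c2_12, c2_13, c2_14]; ring
  have c1_2 : cell w a b c y 2 = cell (Function.update (Function.update (Function.update w s(a, b) 0) s(a, c) 0) s(a, y) 0) a b c y 2 - ((Function.update (Function.update w s(a, b) 0) s(a, c) 0) s(a, y) : ℝ) * cell (Function.update (Function.update (Function.update w s(a, b) 0) s(a, c) 0) s(a, y) 0) a b c y 2 - ((Function.update w s(a, b) 0) s(a, c) : ℝ) * cell (Function.update (Function.update (Function.update w s(a, b) 0) s(a, c) 0) s(a, y) 0) a b c y 2 + ((Function.update w s(a, b) 0) s(a, c) : ℝ) * ((Function.update (Function.update w s(a, b) 0) s(a, c) 0) s(a, y) : ℝ) * cell (Function.update (Function.update (Function.update w s(a, b) 0) s(a, c) 0) s(a, y) 0) a b c y 2 - (w s(a, b) : ℝ) * cell (Function.update (Function.update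 (Function.update w s(a, b) 0) s(a, c) 0) s(a, y) 0) a b c y 2 + (w s(a, b) : ℝ) * ((Function.update (Function.update w s(a, b) 0) s(a, c) 0) s(a, y) : ℝ) * cell (Function.update (Function.update (Function.update w s(a, b) 0) s(a, c) 0) s(a, y) 0) a b c y 2 + (w s(a, b) : ℝ) * ((Function.update w s(a, b) 0) s(a, c) : ℝ) * cell (Function.update (Function.update (Function.update w s(a, b) 0) s(a, c) 0) s(a, y) 0) a b c y 2 - (w s(a, b) : ℝ) * ((Function.update w s(a, b) 0) s(a, c) : ℝ) * ((Function.update (Function.update w s(a, b) 0) s(a, c) 0) s(a, y) : ℝ) * cell (Function.update (Function.update (Function.update w s(a, b) 0) s(a, c) 0) s(a, y) 0) a b c y 2 := by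
    have h := cell_update_one' w a b c y 0 1 (p := a) (q := b) rfl rfl 2; simp (config := {decide := true}) only [ite_true, ite_false, add_zero, zero_add] at h
    rw [SingleSourceLaw.cell_oneBond w s(a, b) a b c y 2, h]; simp only [c2_0, c2_1, c2_2, c2_3, c2_4, c2_5, c2_6, c2_7, c2_8, c2_9, c2_10, c2_11, c2_12, c2_13, c2_14]; ring
  have c1_5 : cell w a b c y 5 = ((Function.update w s(a, b) 0) s(a, c) : ℝ) * cell (Function.update (Function.update (Function.update w s(a, b) 0) s(a, c) 0) s(a, y) 0) a b c y 0 - ((Function.update w s(a, b) 0) s(a, c) : ℝ) * ((Function.update (Function.update w s(a, b) 0) s(a, c) 0) s(a, y) : ℝ) * cell (Function.update (Function.update (Function.update w s(a, b) 0) s(a, c) 0) s(a, y) 0) a b c y 0 - (w s(a, b) : ℝ) * ((Function.update w s(a, b) 0) s(a, c) : ℝ) * cell (Function.update (Function.update (Function.update w s(a, b) 0) s(a, c) 0) s(a, y) 0) a b c y 0 + (w s(a, b) : ℝ) * ((Function.update w s(a, b) 0) s(a, c) : ℝ) * ((Function.update (Function.update w s(a, b) 0) s(a, c) 0) s(a,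 y) : ℝ) * cell (Function.update (Function.update (Function.update w s(a, b) 0) s(a, c) 0) s(a, y) 0) a b c y 0 := by
    have h := cell_update_one' w a b c y 0 1 (p := a) (q := b) rfl rfl 5; simp (config := {decide := true}) only [ite_true, ite_false, add_zero, zero_add] at h
    rw [SingleSourceLaw.cell_oneBond w s(a, b) a b c y 5, h]; simp only [c2_0, c2_1, c2_2, c2_3, c2_4, c2_5, c2_6, c2_7, c2_8, c2_9, c2_10, c2_11, c2_12, c2_13, c2_14]; ring
  have c1_6 : cell w a b c y 6 = (w s(a, b) : ℝ) * cell (Function.update (Function.update (Function.update w s(a, b) 0) s(a, c) 0) s(a, y) 0) a b c y 0 - (w s(a, b) : ℝ) * ((Function.update (Function.update w s(a, b) 0) s(a, c) 0) s(a, y) : ℝ) * cell (Function.update (Function.update (Function.update w s(a, b) 0) s(a, c) 0) s(a, y) 0) a b c y 0 - (w s(a, b) : ℝ) * ((Function.update w s(a, b) 0) s(a, c) : ℝ) * cell (Function.update (Function.update (Function.update w s(a, b) 0) s(a, c) 0) s(a, y) 0) a b c y 0 + (w s(a, b) : ℝ) * ((Function.update w s(a, b) 0) s(a, c) : ℝ)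 * ((Function.update (Function.update w s(a, b) 0) s(a, c) 0) s(a, y) : ℝ) * cell (Function.update (Function.update (Function.update w s(a, b) 0) s(a, c) 0) s(a, y) 0) a b c y 0 := by
    have h := cell_update_one' w a b c y 0 1 (p := a) (q := b) rfl rfl 6; simp (config := {decide := true}) only [ite_true, ite_false, add_zero, zero_add] at h
    rw [SingleSourceLaw.cell_oneBond w s(a, b) a b c y 6, h]; simp only [c2_0, c2_1, c2_2, c2_3, c2_4, c2_5, c2_6, c2_7, c2_8, c2_9, c2_10, c2_11, c2_12, c2_13, c2_14]; ring
  have c1_7 : cell w a b c y 7 = cell (Function.update (Function.update (Function.update w s(a, b) 0) s(a, c) 0) s(a, y) 0) a b c y 7 - ((Function.update (Function.update w s(a, b) 0) s(a, c) 0) s(a, y) : ℝ) * cell (Function.update (Function.update (Function.update w s(a, b) 0) s(a, c) 0) s(a, y) 0) a b c y 7 - ((Function.update w s(a, b) 0) s(a, c) : ℝ) * cell (Function.update (Function.update (Function.update w s(a, b) 0) s(a, c) 0) s(a, y) 0) a b c y 7 + ((Function.update w s(a, b) 0) s(a, c) : ℝ) * ((Function.update (Function.update w s(a, b) 0) s(a,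 c) 0) s(a, y) : ℝ) * cell (Function.update (Function.update (Function.update w s(a, b) 0) s(a, c) 0) s(a, y) 0) a b c y 7 - (w s(a, b) : ℝ) * cell (Function.update (Function.update (Function.update w s(a, b) 0) s(a, c) 0) s(a, y) 0) a b c y 7 + (w s(a, b) : ℝ) * ((Function.update (Function.update w s(a, b) 0) s(a, c) 0) s(a, y) : ℝ) * cell (Function.update (Function.update (Function.update w s(a, b) 0) s(a, c) 0) s(a, y) 0) a b c y 7 + (w s(a, b) : ℝ) * ((Function.update w s(a, b) 0) s(a, c) : ℝ) * cell (Function.update (Function.update (Function.update w s(a, b) 0) s(a, c) 0) s(a, y) 0) a b c y 7 - (w s(a, b) : ℝ) * ((Function.update w s(a, b) 0) s(a, c) : ℝ) * ((Function.update (Function.update w s(a, b) 0) s(a, c) 0) s(a, y) : ℝ) * cell (Function.update (Function.update (Function.update w s(a, b) 0) s(a, c) 0) s(a, y) 0) a b c y 7 := by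
    have h := cell_update_one' w a b c y 0 1 (p := a) (q := b) rfl rfl 7; simp (config := {decide := true}) only [ite_true, ite_false, add_zero, zero_add] at h
    rw [SingleSourceLaw.cell_oneBond w s(a, b) a b c y 7, h]; simp only [c2_0, c2_1, c2_2, c2_3, c2_4, c2_5, c2_6, c2_7, c2_8, c2_9, c2_10, c2_11, c2_12, c2_13, c2_14]; ring
  have c1_8 : cell w a b c y 8 = ((Function.update (Function.update w s(a, b) 0) s(a, c) 0) s(a, y) : ℝ) * cell (Function.update (Function.update (Function.update w s(a, b) 0) s(a, c) 0) s(a, y) 0) a b c y 3 - ((Function.update w s(a, b) 0) s(a, c) : ℝ) * ((Function.update (Function.update w s(a, b) 0) s(a, c) 0) s(a, y) : ℝ) * cell (Function.update (Function.update (Function.update w s(a, b) 0) s(a, c) 0) s(a, y) 0) a b c y 3 - (w s(a, b) : ℝ) * ((Function.update (Function.update w s(a, b) 0) s(a, c) 0) s(a, y) : ℝ) * cell (Function.update (Function.update (Function.update w s(a, b) 0) s(a, c) 0) s(a, y) 0) a b c y 3 + (w s(a, b) : ℝ) * ((Function.update w s(a, b) 0) s(a, c) : ℝ) * ((Function.update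 (Function.update w s(a, b) 0) s(a, c) 0) s(a, y) : ℝ) * cell (Function.update (Function.update (Function.update w s(a, b) 0) s(a, c) 0) s(a, y) 0) a b c y 3 := by
    have h := cell_update_one' w a b c y 0 1 (p := a) (q := b) rfl rfl 8; simp (config := {decide := true}) only [ite_true, ite_false, add_zero, zero_add] at h
    rw [SingleSourceLaw.cell_oneBond w s(a, b) a b c y 8, h]; simp only [c2_0, c2_1, c2_2, c2_3, c2_4, c2_5, c2_6, c2_7, c2_8, c2_9, c2_10, c2_11, c2_12, c2_13, c2_14]; ring
  have c1_9 : cell w a b c y 9 = ((Function.update w s(a, b) 0) s(a, c) : ℝ) * cell (Function.update (Function.update (Function.update w s(a, b) 0) s(a, c) 0) s(a, y) 0) a b c y 2 - ((Function.update w s(a, b) 0) s(a, c) : ℝ) * ((Function.update (Function.update w s(a, b) 0) s(a, c) 0) s(a, y) : ℝ) * cell (Function.update (Function.update (Function.update w s(a, b) 0) s(a, c) 0) s(a, y) 0) a b c y 2 - (w s(a, b) : ℝ) * ((Function.update w s(a, b) 0) s(a, c) : ℝ) * cell (Function.update (Function.update (Function.update w s(a, b) 0) s(a, c) 0) s(a,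 y) 0) a b c y 2 + (w s(a, b) : ℝ) * ((Function.update w s(a, b) 0) s(a, c) : ℝ) * ((Function.update (Function.update w s(a, b) 0) s(a, c) 0) s(a, y) : ℝ) * cell (Function.update (Function.update (Function.update w s(a, b) 0) s(a, c) 0) s(a, y) 0) a b c y 2 := by
    have h := cell_update_one' w a b c y 0 1 (p := a) (q := b) rfl rfl 9; simp (config := {decide := true}) only [ite_true, ite_false, add_zero, zero_add] at h
    rw [SingleSourceLaw.cell_oneBond w s(a, b) a b c y 9, h]; simp only [c2_0, c2_1, c2_2, c2_3, c2_4, c2_5, c2_6, c2_7, c2_8, c2_9, c2_10, c2_11, c2_12, c2_13, c2_14]; ring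
  have c1_10 : cell w a b c y 10 = ((Function.update (Function.update w s(a, b) 0) s(a, c) 0) s(a, y) : ℝ) * cell (Function.update (Function.update (Function.update w s(a, b) 0) s(a, c) 0) s(a, y) 0) a b c y 1 + ((Function.update w s(a, b) 0) s(a, c) : ℝ) * cell (Function.update (Function.update (Function.update w s(a, b) 0) s(a, c) 0) s(a, y) 0) a b c y 1 - ((Function.update w s(a, b) 0) s(a, c) : ℝ) * ((Function.update (Function.update w s(a, b) 0) s(a, c) 0) s(a, y) : ℝ) * cell (Function.update (Function.update (Function.update w s(a, b) 0) s(a, c) 0) s(a, y) 0) a b c y 1 + ((Function.update w s(a, b) 0) s(a, c) : ℝ) * ((Function.update (Function.update w s(a, b) 0) s(a, c) 0) s(a, y) : ℝ) * cell (Function.update (Function.update (Function.update w s(a, b) 0) s(a, c) 0) s(a, y) 0) a b c y 0 - (w s(a, b) : ℝ) * ((Function.update (Function.update w s(a, b) 0) s(a, c) 0) s(a, y) : ℝ) * cell (Function.update (Function.update (Function.update w s(a, b) 0) s(a, c) 0) s(a, y) 0) a b c y 1 - (w s(a, b) : ℝ) * ((Function.update w s(a, b) 0) s(a, c) : ℝ)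 * cell (Function.update (Function.update (Function.update w s(a, b) 0) s(a, c) 0) s(a, y) 0) a b c y 1 + (w s(a, b) : ℝ) * ((Function.update w s(a, b) 0) s(a, c) : ℝ) * ((Function.update (Function.update w s(a, b) 0) s(a, c) 0) s(a, y) : ℝ) * cell (Function.update (Function.update (Function.update w s(a, b) 0) s(a, c) 0) s(a, y) 0) a b c y 1 - (w s(a, b) : ℝ) * ((Function.update w s(a, b) 0) s(a, c) : ℝ) * ((Function.update (Function.update w s(a, b) 0) s(a, c) 0) s(a, y) : ℝ) * cell (Function.update (Function.update (Function.update w s(a, b) 0) s(a, c) 0) s(a, y) 0) a b c y 0 := by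
    have h := cell_update_one' w a b c y 0 1 (p := a) (q := b) rfl rfl 10; simp (config := {decide := true}) only [ite_true, ite_false, add_zero, zero_add] at h
    rw [SingleSourceLaw.cell_oneBond w s(a, b) a b c y 10, h]; simp only [c2_0, c2_1, c2_2, c2_3, c2_4, c2_5, c2_6, c2_7, c2_8, c2_9, c2_10, c2_11, c2_12, c2_13, c2_14]; ring
  have c1_11 : cell w a b c y 11 = (w s(a, b) : ℝ) * cell (Function.update (Function.update (Function.update w s(a, b) 0) s(a, c) 0) s(a, y) 0) a b c y 1 - (w s(a, b) : ℝ) * ((Function.update (Function.update w s(a, b) 0) s(a, c) 0) s(a, y) : ℝ) * cell (Function.update (Function.update (Function.update w s(a, b) 0) s(a, c) 0) s(a, y) 0) a b c y 1 - (w s(a, b) : ℝ) * ((Function.update w s(a, b) 0) s(a, c) : ℝ) * cell (Function.update (Function.update (Function.update w s(a, b) 0) s(a, c) 0) s(a, y) 0) a b c y 1 + (w s(a, b) : ℝ) * ((Function.update w s(a, b) 0) s(a, c) : ℝ) * ((Function.update (Function.update w s(a, b) 0) s(a, c) 0) s(a, y) : ℝ) * cell (Function.update (Function.update (Function.update w s(a,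 b) 0) s(a, c) 0) s(a, y) 0) a b c y 1 := by
    have h := cell_update_one' w a b c y 0 1 (p := a) (q := b) rfl rfl 11; simp (config := {decide := true}) only [ite_true, ite_false, add_zero, zero_add] at h
    rw [SingleSourceLaw.cell_oneBond w s(a, b) a b c y 11, h]; simp only [c2_0, c2_1, c2_2, c2_3, c2_4, c2_5, c2_6, c2_7, c2_8, c2_9, c2_10, c2_11, c2_12, c2_13, c2_14]; ring
  have c1_12 : cell w a b c y 12 = ((Function.update (Function.update w s(a, b) 0) s(a, c) 0) s(a, y) : ℝ) * cell (Function.update (Function.update (Function.update w s(a, b) 0) s(a, c) 0) s(a, y) 0) a b c y 2 - ((Function.update w s(a, b) 0) s(a, c) : ℝ) * ((Function.update (Function.update w s(a, b) 0) s(a, c) 0) s(a, y) : ℝ) * cell (Function.update (Function.update (Function.update w s(a, b) 0) s(a, c) 0) s(a, y) 0) a b c y 2 + (w s(a, b) : ℝ) * cell (Function.update (Function.update (Function.update w s(a, b) 0) s(a, c) 0) s(a, y) 0) a b c y 2 - (w s(a, b) : ℝ) * ((Function.update (Function.update w s(a, b) 0) s(a, c) 0) s(a, y) : ℝ) * cell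 (Function.update (Function.update (Function.update w s(a, b) 0) s(a, c) 0) s(a, y) 0) a b c y 2 + (w s(a, b) : ℝ) * ((Function.update (Function.update w s(a, b) 0) s(a, c) 0) s(a, y) : ℝ) * cell (Function.update (Function.update (Function.update w s(a, b) 0) s(a, c) 0) s(a, y) 0) a b c y 0 - (w s(a, b) : ℝ) * ((Function.update w s(a, b) 0) s(a, c) : ℝ) * cell (Function.update (Function.update (Function.update w s(a, b) 0) s(a, c) 0) s(a, y) 0) a b c y 2 + (w s(a, b) : ℝ) * ((Function.update w s(a, b) 0) s(a, c) : ℝ) * ((Function.update (Function.update w s(a, b) 0) s(a, c) 0) s(a, y) : ℝ) * cell (Function.update (Function.update (Function.update w s(a, b) 0) s(a, c) 0) s(a, y) 0) a b c y 2 - (w s(a, b) : ℝ) * ((Function.update w s(a, b) 0) s(a, c) : ℝ) * ((Function.update (Function.update w s(a, b) 0) s(a, c) 0) s(a, y) : ℝ) * cell (Function.update (Function.update (Function.update w s(a, b) 0) s(a, c) 0) s(a, y) 0) a b c y 0 := by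
    have h := cell_update_one' w a b c y 0 1 (p := a) (q := b) rfl rfl 12; simp (config := {decide := true}) only [ite_true, ite_false, add_zero, zero_add] at h
    rw [SingleSourceLaw.cell_oneBond w s(a, b) a b c y 12, h]; simp only [c2_0, c2_1, c2_2, c2_3, c2_4, c2_5, c2_6, c2_7, c2_8, c2_9, c2_10, c2_11, c2_12, c2_13, c2_14]; ring
  have c1_13 : cell w a b c y 13 = ((Function.update w s(a, b) 0) s(a, c) : ℝ) * cell (Function.update (Function.update (Function.update w s(a, b) 0) s(a, c) 0) s(a, y) 0) a b c y 3 - ((Function.update w s(a, b) 0) s(a, c) : ℝ) * ((Function.update (Function.update w s(a, b) 0) s(a, c) 0) s(a, y) : ℝ) * cell (Function.update (Function.update (Function.update w s(a, b) 0) s(a, c) 0) s(a, y) 0) a b c y 3 + (w s(a, b) : ℝ) * cell (Function.update (Function.update (Function.update w s(a, b) 0) s(a, c) 0) s(a, y) 0) a b c y 3 - (w s(a, b) : ℝ) * ((Function.update (Function.update w s(a, b) 0) s(a, c) 0) s(a, y) : ℝ) * cell (Function.update (Function.update (Function.update w s(a, b) 0) s(a, c) 0) s(a, y) 0) a b c y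 3 - (w s(a, b) : ℝ) * ((Function.update w s(a, b) 0) s(a, c) : ℝ) * cell (Function.update (Function.update (Function.update w s(a, b) 0) s(a, c) 0) s(a, y) 0) a b c y 3 + (w s(a, b) : ℝ) * ((Function.update w s(a, b) 0) s(a, c) : ℝ) * cell (Function.update (Function.update (Function.update w s(a, b) 0) s(a, c) 0) s(a, y) 0) a b c y 0 + (w s(a, b) : ℝ) * ((Function.update w s(a, b) 0) s(a, c) : ℝ) * ((Function.update (Function.update w s(a, b) 0) s(a, c) 0) s(a, y) : ℝ) * cell (Function.update (Function.update (Function.update w s(a, b) 0) s(a, c) 0) s(a, y) 0) a b c y 3 - (w s(a, b) : ℝ) * ((Function.update w s(a, b) 0) s(a, c) : ℝ) * ((Function.update (Function.update w s(a, b) 0) s(a, c) 0) s(a, y) : ℝ) * cell (Function.update (Function.update (Function.update w s(a, b) 0) s(a, c) 0) s(a, y) 0) a b c y 0 := by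
    have h := cell_update_one' w a b c y 0 1 (p := a) (q := b) rfl rfl 13; simp (config := {decide := true}) only [ite_true, ite_false, add_zero, zero_add] at h
    rw [SingleSourceLaw.cell_oneBond w s(a, b) a b c y 13, h]; simp only [c2_0, c2_1, c2_2, c2_3, c2_4, c2_5, c2_6, c2_7, c2_8, c2_9, c2_10, c2_11, c2_12, c2_13, c2_14]; ring
  have c1_14 : cell w a b c y 14 = ((Function.update (Function.update w s(a, b) 0) s(a, c) 0) s(a, y) : ℝ) * cell (Function.update (Function.update (Function.update w s(a, b) 0) s(a, c) 0) s(a, y) 0) a b c y 7 + ((Function.update w s(a, b) 0) s(a, c) : ℝ) * cell (Function.update (Function.update (Function.update w s(a, b) 0) s(a, c) 0) s(a, y) 0) a b c y 7 - ((Function.update w s(a, b) 0) s(a, c) : ℝ) * ((Function.update (Function.update w s(a, b) 0) s(a, c) 0) s(a, y) : ℝ) * cell (Function.update (Function.update (Function.update w s(a, b) 0) s(a, c) 0) s(a, y) 0) a b c y 7 + ((Function.update w s(a, b) 0) s(a, c) : ℝ) * ((Function.update (Function.update w s(a, b) 0) s(a, c) 0) s(a, y) : ℝ) * cell (Function.update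 (Function.update (Function.update w s(a, b) 0) s(a, c) 0) s(a, y) 0) a b c y 3 + ((Function.update w s(a, b) 0) s(a, c) : ℝ) * ((Function.update (Function.update w s(a, b) 0) s(a, c) 0) s(a, y) : ℝ) * cell (Function.update (Function.update (Function.update w s(a, b) 0) s(a, c) 0) s(a, y) 0) a b c y 2 + (w s(a, b) : ℝ) * cell (Function.update (Function.update (Function.update w s(a, b) 0) s(a, c) 0) s(a, y) 0) a b c y 7 - (w s(a, b) : ℝ) * ((Function.update (Function.update w s(a, b) 0) s(a, c) 0) s(a, y) : ℝ) * cell (Function.update (Function.update (Function.update w s(a, b) 0) s(a, c) 0) s(a, y) 0) a b c y 7 + (w s(a, b) : ℝ) * ((Function.update (Function.update w s(a, b) 0) s(a, c) 0) s(a, y) : ℝ) * cell (Function.update (Function.update (Function.update w s(a, b) 0) s(a, c) 0) s(a, y) 0) a b c y 3 + (w s(a, b) : ℝ) * ((Function.update (Function.update w s(a, b) 0) s(a, c) 0) s(a, y) : ℝ) * cell (Function.update (Function.update (Function.update w s(a, b) 0) s(a, c) 0) s(a, y) 0) a b c y 1 - (w s(a, b) : ℝ) * ((Function.update w s(a, b)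 0) s(a, c) : ℝ) * cell (Function.update (Function.update (Function.update w s(a, b) 0) s(a, c) 0) s(a, y) 0) a b c y 7 + (w s(a, b) : ℝ) * ((Function.update w s(a, b) 0) s(a, c) : ℝ) * cell (Function.update (Function.update (Function.update w s(a, b) 0) s(a, c) 0) s(a, y) 0) a b c y 2 + (w s(a, b) : ℝ) * ((Function.update w s(a, b) 0) s(a, c) : ℝ) * cell (Function.update (Function.update (Function.update w s(a, b) 0) s(a, c) 0) s(a, y) 0) a b c y 1 + (w s(a, b) : ℝ) * ((Function.update w s(a, b) 0) s(a, c) : ℝ) * ((Function.update (Function.update w s(a, b) 0) s(a, c) 0) s(a, y) : ℝ) * cell (Function.update (Function.update (Function.update w s(a, b) 0) s(a, c) 0) s(a, y) 0) a b c y 7 - (w s(a, b) : ℝ) * ((Function.update w s(a, b) 0) s(a, c) : ℝ) * ((Function.update (Function.update w s(a, b) 0) s(a, c) 0) s(a, y) : ℝ) * cell (Function.update (Function.update (Function.update w s(a, b) 0) s(a, c) 0) s(a, y) 0) a b c y 3 - (w s(a, b) : ℝ) * ((Function.update w s(a, b) 0) s(a, c) : ℝ) * ((Function.update (Function.update w s(a,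 b) 0) s(a, c) 0) s(a, y) : ℝ) * cell (Function.update (Function.update (Function.update w s(a, b) 0) s(a, c) 0) s(a, y) 0) a b c y 2 - (w s(a, b) : ℝ) * ((Function.update w s(a, b) 0) s(a, c) : ℝ) * ((Function.update (Function.update w s(a, b) 0) s(a, c) 0) s(a, y) : ℝ) * cell (Function.update (Function.update (Function.update w s(a, b) 0) s(a, c) 0) s(a, y) 0) a b c y 1 + (w s(a, b) : ℝ) * ((Function.update w s(a, b) 0) s(a, c) : ℝ) * ((Function.update (Function.update w s(a, b) 0) s(a, c) 0) s(a, y) : ℝ) * cell (Function.update (Function.update (Function.update w s(a, b) 0) s(a, c) 0) s(a, y) 0) a b c y 0 := by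
    have h := cell_update_one' w a b c y 0 1 (p := a) (q := b) rfl rfl 14; simp (config := {decide := true}) only [ite_true, ite_false, add_zero, zero_add] at h
    rw [SingleSourceLaw.cell_oneBond w s(a, b) a b c y 14, h]; simp only [c2_0, c2_1, c2_2, c2_3, c2_4, c2_5, c2_6, c2_7, c2_8, c2_9, c2_10, c2_11, c2_12, c2_13, c2_14]; ring
  -- Aas–Gladkov for (b,c,y) under w₀, nonnegativity, and the certificate
  have hsk := sk3_bcy_cells' (Function.update (Function.update (Function.update w s(a, b) 0) s(a, c) 0) s(a, y) 0) a b c y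
  simp only [h4, h5, h6, h8, h9, h10, h11, h12, h13, h14, add_zero] at hsk
  have hq := cell_nonneg (Function.update (Function.update (Function.update w s(a, b) 0) s(a, c) 0) s(a, y) 0) a b c y 0
  have hub := cell_nonneg (Function.update (Function.update (Function.update w s(a, b) 0) s(a, c) 0) s(a, y) 0) a b c y 1
  have huc := cell_nonneg (Function.update (Function.update (Function.update w s(a, b) 0) s(a, c) 0) s(a, y) 0) a b c y 2
  have huy := cell_nonneg (Function.update (Function.update (Function.update w s(a, b) 0) s(a, c) 0) s(a, y) 0) a b c y 3
  have hx := cell_nonneg (Function.update (Function.update (Function.update w s(a, b) 0) s(a, c) 0) s(a, y) 0) a b c y 7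
  have hA0 : 0 ≤ (w s(a, b) : ℝ) := unitInterval.nonneg _
  have hA1 : (w s(a, b) : ℝ) ≤ 1 := unitInterval.le_one _
  have hB0 : 0 ≤ ((Function.update w s(a, b) 0) s(a, c) : ℝ) := unitInterval.nonneg _
  have hB1 : ((Function.update w s(a, b) 0) s(a, c) : ℝ) ≤ 1 := unitInterval.le_one _
  have hG0 : 0 ≤ ((Function.update (Function.update w s(a, b) 0) s(a, c) 0) s(a, y) : ℝ) := unitInterval.nonneg _
  have hG1 : ((Function.update (Function.update w s(a, b) 0) s(a, c) 0) s(a, y) : ℝ) ≤ 1 := unitInterval.le_one _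
  have h1a : 0 ≤ 1 - (w s(a, b) : ℝ) := sub_nonneg.mpr hA1
  have h1b : 0 ≤ 1 - ((Function.update w s(a, b) 0) s(a, c) : ℝ) := sub_nonneg.mpr hB1
  have h1g : 0 ≤ 1 - ((Function.update (Function.update w s(a, b) 0) s(a, c) 0) s(a, y) : ℝ) := sub_nonneg.mpr hG1
  have hin1 : 0 ≤ (w s(a, b) : ℝ) + ((Function.update w s(a, b) 0) s(a, c) : ℝ) + ((Function.update (Function.update w s(a, b) 0) s(a, c) 0) s(a, y) : ℝ) * (2 - (w s(a, b) : ℝ) - ((Function.update w s(a, b) 0) s(a, c) : ℝ)) := by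
    have := mul_nonneg hG0 (show (0:ℝ) ≤ 2 - (w s(a, b) : ℝ) - ((Function.update w s(a, b) 0) s(a, c) : ℝ) by linarith only [hA1, hB1])
    linarith only [this, hA0, hB0]
  have hCqx : 0 ≤ ((1 - ((Function.update (Function.update w s(a, b) 0) s(a, c) 0) s(a, y) : ℝ)) * (1 - (w s(a, b) : ℝ)) * (1 - ((Function.update w s(a, b) 0) s(a, c) : ℝ)) * ((w s(a, b) : ℝ) + ((Function.update w s(a, b) 0) s(a, c) : ℝ) + ((Function.update (Function.update w s(a, b) 0) s(a, c) 0) s(a, y) : ℝ) * (2 - (w s(a, b) : ℝ) - ((Function.update w s(a, b) 0) s(a, c) : ℝ)))) :=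
    mul_nonneg (mul_nonneg (mul_nonneg h1g h1a) h1b) hin1
  have hfbc : 0 ≤ (((Function.update (Function.update w s(a, b) 0) s(a, c) 0) s(a, y) : ℝ) * (1 - ((Function.update (Function.update w s(a, b) 0) s(a, c) 0) s(a, y) : ℝ)) * ((w s(a, b) : ℝ) * (1 - (w s(a, b) : ℝ)) * (1 - ((Function.update w s(a, b) 0) s(a, c) : ℝ)) + ((Function.update w s(a, b) 0) s(a, c) : ℝ) * (1 - ((Function.update w s(a, b) 0) s(a, c) : ℝ)) * (1 - (w s(a, b) : ℝ)))) :=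
    mul_nonneg (mul_nonneg hG0 h1g) (add_nonneg (mul_nonneg (mul_nonneg hA0 h1a) h1b) (mul_nonneg (mul_nonneg hB0 h1b) h1a))
  have hin2 : 0 ≤ (w s(a, b) : ℝ) * (1 - ((Function.update (Function.update w s(a, b) 0) s(a, c) 0) s(a, y) : ℝ)) + 2 * ((Function.update (Function.update w s(a, b) 0) s(a, c) 0) s(a, y) : ℝ) := add_nonneg (mul_nonneg hA0 h1g) (by linarith only [hG0])
  have hfby : 0 ≤ (((Function.update w s(a, b) 0) s(a, c) : ℝ) * (1 - ((Function.update w s(a, b) 0) s(a, c) : ℝ)) * (1 - ((Function.update (Function.update w s(a, b) 0) s(a, c) 0) s(a, y) : ℝ)) * (1 - (w s(a, b) : ℝ)) * ((w s(a, b) : ℝ) * (1 - ((Function.update (Function.update w s(a, b) 0) s(a, c) 0) s(a, y) : ℝ)) + 2 * ((Function.update (Function.update w s(a, b) 0) s(a, c) 0) s(a, y) : ℝ))) :=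
    mul_nonneg (mul_nonneg (mul_nonneg (mul_nonneg hB0 h1b) h1g) h1a) hin2
  have hab1 : (w s(a, b) : ℝ) * ((Function.update w s(a, b) 0) s(a, c) : ℝ) ≤ 1 := mul_le_one₀ hA1 hB0 hB1
  have hin3 : 0 ≤ (w s(a, b) : ℝ) * ((Function.update w s(a, b) 0) s(a, c) : ℝ) + ((Function.update (Function.update w s(a, b) 0) s(a, c) 0) s(a, y) : ℝ) * (2 - (w s(a, b) : ℝ) * ((Function.update w s(a, b) 0) s(a, c) : ℝ)) :=
    add_nonneg (mul_nonneg hA0 hB0) (mul_nonneg hG0 (by linarith only [hab1]))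
  have hfcy : 0 ≤ ((1 - ((Function.update (Function.update w s(a, b) 0) s(a, c) 0) s(a, y) : ℝ)) * (1 - (w s(a, b) : ℝ)) * (1 - ((Function.update w s(a, b) 0) s(a, c) : ℝ)) * ((w s(a, b) : ℝ) * ((Function.update w s(a, b) 0) s(a, c) : ℝ) + ((Function.update (Function.update w s(a, b) 0) s(a, c) 0) s(a, y) : ℝ) * (2 - (w s(a, b) : ℝ) * ((Function.update w s(a, b) 0) s(a, c) : ℝ)))) :=
    mul_nonneg (mul_nonneg (mul_nonneg h1g h1a) h1b) hin3
  have hCqb : 0 ≤ ((w s(a, b) : ℝ) * ((Function.update w s(a, b) 0) s(a, c) : ℝ) * ((Function.update (Function.update w s(a, b) 0) s(a, c) 0) s(a, y) : ℝ) * (1 - (w s(a, b) : ℝ)) * (1 - ((Function.update w s(a, b) 0) s(a, c) : ℝ)) * (1 - ((Function.update (Function.update w s(a, b) 0) s(a, c) 0) s(a, y) : ℝ))) :=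
    mul_nonneg (mul_nonneg (mul_nonneg (mul_nonneg (mul_nonneg hA0 hB0) hG0) h1a) h1b) h1g
  have hCqy : 0 ≤ (2 * ((Function.update w s(a, b) 0) s(a, c) : ℝ) * ((Function.update (Function.update w s(a, b) 0) s(a, c) 0) s(a, y) : ℝ) * (1 - (w s(a, b) : ℝ)) * (1 - ((Function.update w s(a, b) 0) s(a, c) : ℝ)) * (1 - ((Function.update (Function.update w s(a, b) 0) s(a, c) 0) s(a, y) : ℝ))) :=
    mul_nonneg (mul_nonneg (mul_nonneg (mul_nonneg (mul_nonneg (by norm_num) hB0) hG0) h1a) h1b) h1g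
  have hsk' : 0 ≤ (cell (Function.update (Function.update (Function.update w s(a, b) 0) s(a, c) 0) s(a, y) 0) a b c y 7 * cell (Function.update (Function.update (Function.update w s(a, b) 0) s(a, c) 0) s(a, y) 0) a b c y 0 - (cell (Function.update (Function.update (Function.update w s(a, b) 0) s(a, c) 0) s(a, y) 0) a b c y 3 * cell (Function.update (Function.update (Function.update w s(a, b) 0) s(a, c) 0) s(a, y) 0) a b c y 2 + cell (Function.update (Function.update (Function.update w s(a, b) 0) s(a, c) 0) s(a, y) 0) a b c y 3 * cell (Function.update (Function.update (Function.update w s(a, b) 0) s(a, c) 0) s(a, y) 0) a b c y 1 + cell (Function.update (Function.update (Function.update w s(a, b) 0) s(a, c) 0) s(a, y) 0) a b c y 2 * cell (Function.update (Function.update (Function.update w s(a, b) 0) s(a, c) 0) s(a, y) 0) a b c y 1)) := by linarith only [hsk]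
  have s1 := mul_nonneg hCqx hsk'
  have s2 := mul_nonneg hfbc (mul_nonneg hub huc)
  have s3 := mul_nonneg hfby (mul_nonneg hub huy)
  have s4 := mul_nonneg hfcy (mul_nonneg huc huy)
  have s5 := mul_nonneg hCqb (mul_nonneg hq hub)
  have s6 := mul_nonneg hCqb (mul_nonneg hq huc)
  have s7 := mul_nonneg hCqy (mul_nonneg hq huy)
  rw [c1_0, c1_1, c1_2, c1_5, c1_6, c1_7, c1_8, c1_9, c1_10, c1_11, c1_12, c1_13, c1_14]
  linarith only [s1, s2, s3, s4, s5, s6, s7]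

/-- **Conjecture W (row `Q44`, all `n`) when `a` is cut off from `b, c, y` once its three terminal pairs are closed** — in
particular on every finite weighted graph in which each neighbour of `a` of positive weight is a terminal (any weights on
`s(a,b), s(a,c), s(a,y)`): with `w₀ = w[s(a,b)↦0][s(a,c)↦0][s(a,y)↦0]`, if `P_{w₀}(a↔b) = P_{w₀}(a↔c) = P_{w₀}(a↔y) = 0` then
`2(c₁₁c₉ + c₁₁c₈ + c₆c₈ + c₆c₁ + c₁c₈) + (c₂c₁₃ + c₁c₁₃ + c₅c₁₂ + c₁c₁₂ + c₆c₁₀ + c₆c₇ + c₂c₁₀ + c₅c₇) ≤ 2(c₁₁+c₁₄)c₀`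
(the literal cell form of Conjecture W, `ConjW.q44_cells_of_mixW` / `TwoCopyMono.sum_kerQ44_cell`). [this work] -/
theorem q44_cells_of_terminal_ports (w : Sym2 (Fin n) → unitInterval) (a b c y : Fin n)
    (hb : (prodBernoulli (Function.update (Function.update (Function.update w s(a, b) 0) s(a, c) 0) s(a, y) 0)).real (openConn a b) = 0)
    (hc : (prodBernoulli (Function.update (Function.update (Function.update w s(a, b) 0) s(a, c) 0) s(a, y) 0)).real (openConn a c) = 0)
    (hy : (prodBernoulli (Function.update (Function.update (Function.update w s(a, b) 0) s(a, c) 0) s(a, y) 0)).real (openConn a y) = 0) :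
    2 * (cell w a b c y 11 * cell w a b c y 9 + cell w a b c y 11 * cell w a b c y 8 + cell w a b c y 6 * cell w a b c y 8 + cell w a b c y 6 * cell w a b c y 1 + cell w a b c y 1 * cell w a b c y 8) +
        (cell w a b c y 2 * cell w a b c y 13 + cell w a b c y 1 * cell w a b c y 13 + cell w a b c y 5 * cell w a b c y 12 + cell w a b c y 1 * cell w a b c y 12 + cell w a b c y 6 * cell w a b c y 10 + cell w a b c y 6 * cell w a b c y 7 +
          cell w a b c y 2 * cell w a b c y 10 + cell w a b c y 5 * cell w a b c y 7) ≤
      2 * ((cell w a b c y 11 + cell w a b c y 14) * cell w a b c y 0) := by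
  have e4 : cell (Function.update (Function.update (Function.update w s(a, b) 0) s(a, c) 0) s(a, y) 0) a b c y 4 = 0 :=
    le_antisymm ((SingleSourceLaw.cell_le_real_openConn _ a b c y 4 3 (by decide)).trans (le_of_eq hy)) (cell_nonneg _ _ _ _ _ _)
  have e5 : cell (Function.update (Function.update (Function.update w s(a, b) 0) s(a, c) 0) s(a, y) 0) a b c y 5 = 0 :=
    le_antisymm ((SingleSourceLaw.cell_le_real_openConn _ a b c y 5 2 (by decide)).trans (le_of_eq hc)) (cell_nonneg _ _ _ _ _ _)
  have e6 : cell (Function.update (Function.update (Function.update w s(a, b) 0) s(a, c) 0) s(a, y) 0) a b c y 6 = 0 :=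
    le_antisymm ((SingleSourceLaw.cell_le_real_openConn _ a b c y 6 1 (by decide)).trans (le_of_eq hb)) (cell_nonneg _ _ _ _ _ _)
  have e8 : cell (Function.update (Function.update (Function.update w s(a, b) 0) s(a, c) 0) s(a, y) 0) a b c y 8 = 0 :=
    le_antisymm ((SingleSourceLaw.cell_le_real_openConn _ a b c y 8 3 (by decide)).trans (le_of_eq hy)) (cell_nonneg _ _ _ _ _ _)
  have e9 : cell (Function.update (Function.update (Function.update w s(a, b) 0) s(a, c) 0) s(a, y) 0) a b c y 9 = 0 :=
    le_antisymm ((SingleSourceLaw.cell_le_real_openConn _ a b c y 9 2 (by decide)).trans (le_of_eq hc)) (cell_nonneg _ _ _ _ _ _)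
  have e10 : cell (Function.update (Function.update (Function.update w s(a, b) 0) s(a, c) 0) s(a, y) 0) a b c y 10 = 0 :=
    le_antisymm ((SingleSourceLaw.cell_le_real_openConn _ a b c y 10 2 (by decide)).trans (le_of_eq hc)) (cell_nonneg _ _ _ _ _ _)
  have e11 : cell (Function.update (Function.update (Function.update w s(a, b) 0) s(a, c) 0) s(a, y) 0) a b c y 11 = 0 :=
    le_antisymm ((SingleSourceLaw.cell_le_real_openConn _ a b c y 11 1 (by decide)).trans (le_of_eq hb)) (cell_nonneg _ _ _ _ _ _)
  have e12 : cell (Function.update (Function.update (Function.update w s(a, b) 0) s(a, c) 0) s(a, y) 0) a b c y 12 = 0 :=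
    le_antisymm ((SingleSourceLaw.cell_le_real_openConn _ a b c y 12 1 (by decide)).trans (le_of_eq hb)) (cell_nonneg _ _ _ _ _ _)
  have e13 : cell (Function.update (Function.update (Function.update w s(a, b) 0) s(a, c) 0) s(a, y) 0) a b c y 13 = 0 :=
    le_antisymm ((SingleSourceLaw.cell_le_real_openConn _ a b c y 13 1 (by decide)).trans (le_of_eq hb)) (cell_nonneg _ _ _ _ _ _)
  have e14 : cell (Function.update (Function.update (Function.update w s(a, b) 0) s(a, c) 0) s(a, y) 0) a b c y 14 = 0 :=
    le_antisymm ((SingleSourceLaw.cell_le_real_openConn _ a b c y 14 1 (by decide)).trans (le_of_eq hb)) (cell_nonneg _ _ _ _ _ _)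
  exact q44_cells_of_isolated_core w a b c y e4 e5 e6 e8 e9 e10 e11 e12 e13 e14

end ConjWPort

end Summit.CriticalPhenomena.PercolationContinuityZ3.Theorems
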